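import Mathlib
import HarnessLib
import Summits.HubbardSuperconductivity.HubbardSuperconductivity.Theorems.WeakCouplingBCSKlDualOrder
import Summits.HubbardSuperconductivity.HubbardSuperconductivity.Theorems.ChiralWindowCwKLChiralWindowReductionL2
import Summits.HubbardSuperconductivity.HubbardSuperconductivity.Theorems.WeakCouplingBCSKlDualOrderBracketD030

/-!
# Route `WeakCouplingBCS` / `KLProgramme` — HQ1 (ii): the SECOND dual-ordered pair `m(δ = 0.30) < m(δ = 0.05)` of the Kohn–Luttinger
# rival margin at `t′ = 0`, in ONE currency on both sides (route-P two-sided channel rows; cell gate-hubbard-kl, idea-3 r19, lens dual)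

TURNKEY (idea-3 r19 `Sketch19.lean` d491ecb6d92655a0 + the two bracket-discharged corollaries; filed by a prover seat — this file declares
parametrised `Prop` families, hence `perm.theorems-prover-only`; requires `…KlDualOrderBracketD030` (def-free, idea-3 F1) in the tree first).  Companion of the landed `Theorems/WeakCouplingBCSKlDualOrder.lean` (✓ p721574,
`KlDualOrder.marginOrderT0_d005_d035`: `m(0.35) < m(0.05)` modulo `klCertB1gWinD.EnclosuresB1g` + ONE route-P `B1g` form floor).

THE DUAL READING, ONE STEP FURTHER.  The route-P tables of the cell (cert-2 / margin-2, `routeP4.py`: Galerkin matrix of the `U = 1`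
Lindhard kernel on `N` Fermi-curve nodes per channel, interval-Cholesky / Ostrowski eigenvalue bounds `LB ≤ λ_N ≤ UB`, per-isotypic
discretisation defect `E_χ`; field `channels.<χ>.K_bottom_interval_perchannel = [LB − E_χ, UB + E_χ]`) bound EVERY channel bottom
`Λ₁(χ; μ) = channelInf ε₀ μ 1 χ` from BOTH sides, uniformly on a μ-cell.  Read as named numerical hypotheses of two kinds —
a form FLOOR `Λ ≤ ⟨ψ, L_μ ψ⟩` on normalised channel states (the additive kind of p721574's `B1gFormFloor`, here for any channel:
`ChannelFormFloor`) and a form WITNESS `∃ ψ, ⟨ψ, L_μ ψ⟩ ≤ Λ⁺` for `B1g` (`B1gFormWitness`; the Ritz direction) — they give on a cell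
  FLOOR    `m(μ) ≥ min_{χ ∈ {A2g,B2g,E}} Λ_χ − Λ⁺_B1g`   (`le_rivalMargin_of_routePTwoSided`), and
  CEILING  `m(μ) ≤ −Λ_B1g`                              (p721574 `rivalMargin_le_of_b1gFormFloor`),
and `ceiling(δ₂) < floor(δ₁)` orders two dopings end to end (p721574 `rivalMargin_lt_of_ceiling_floor`), no monotonicity, no transport.

BY VALUE over the whole `t′ = 0` column of SCAN-TABLE v0 (`δ ∈ {0.05, …, 0.35}`; the route-P cell containing the certified bracket of
`μ(δ)`; floor / ceiling per-channel): `0.05: 0.1378 / 0.781 · 0.10: 0.0502 / 0.520 · 0.15: 0.0258 / 0.357 · 0.20: 0.0247 / 0.252 ·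
0.25: 0.0288 / 0.171 · 0.30: 0.0279 / 0.1117 · 0.35: 0.0184 / 0.0573` — so EXACTLY TWO pairs of the column are orderable on the mirrored
corpus at zero kit: `(0.05, 0.35)` (landed) and `(0.05, 0.30)` (THIS file; slack `0.128 − 0.1125 = 0.0155`); the next candidate
`(0.10, 0.35)` misses by `0.007`, `(0.05, 0.25)` by `0.04`.

HONEST FRAMING.  An ORDER statement between two δ-windows at `t′ = 0`, MODULO two named numerical hypotheses of the route-P
(additive / Galerkin) kind, read off EXISTING mirrored jsons of ONE stage-2 implementation (`routeP4.py`; iv2-cross-validated hulls),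
not re-derived in Lean and carrying no DECIDED label: «RoutePTwoSidedD005» := `RoutePTwoSided (−2/25) (−3/40) (−263/500) (−199/500)
(−37/200) (−89/250)` (cells `m0.08010-0.07740-N144` 46efe2a5981588f3 and `m0.07760-0.07490-N144` dd259055255819be of
`HOME/hubbard-kl-cert-2/data/routeP/`, covering the tree bracket `μ(0.05) ∈ [−2/25, −3/40]`; weakest literal of the two cells per row,
rounded OUTWARD: `B1g` upper end `max(−0.526143, −0.534302) ≤ −263/500`, `A2g` lower end `min(−0.388303, −0.397963) ≥ −199/500`,
`B2g` `min(−0.179127, −0.184256) ≥ −37/200`, `E` `min(−0.346866, −0.355355) ≥ −89/250`) and «RoutePB1gFloorD030» :=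
`B1gFormFloor (−29/40) (−287/400) (−9/80)` (cells `m0.72510-0.72240` bf31e9f7a6c0d9cf, `m0.72260-0.71990` d5393b3f62f7af10,
`m0.72010-0.71740-N208` 64e0dd4b5eb97e85 of `HOME/hubbard-kl-cert-2/winXY/data/routeP/`, union `[−0.7251, −0.7174] ⊃ [−29/40, −287/400]`;
`B1g` lower end `min(−0.111045, −0.111716, −0.112396) ≥ −9/80`).  Floats are floats; the per-channel (not the global-`B_N`) error budget is
the currency of record of those tables (their own `certified_gap` field).  Nothing about `t′ ≠ 0`, `K₃`, `U₀`, the window or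
superconductivity; printed BESIDE ✓ p721574, W3′ DECIDED and the (δ)/(ε′) records, replacing nothing.  A Kohn–Luttinger `O(U²)` channel
statement is not ODLRO; nothing here proves superconductivity in the Hubbard model.

LABEL OF RECORD (hypothesis weight; T2-2 pre-read STATUS l.10605, pen (R459)(B)).  This second pair is STRICTLY MORE CONDITIONAL than
✓ p721574: p721574's `δ = 0.05` side is the kernel-DECIDED winD Ritz/far floor `21/200` (`klCertB1gWinD.EnclosuresB1g` of the landed window
record + `winD_top_floorCheck` by `decide +kernel`) and only its `δ = 0.35` ceiling is a route-P term; here that DECIDED floor (`0.105`) does NOT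
clear the `δ = 0.30` ceiling (`0.1125`), so BOTH sides stand on route-P rows — FIVE numerical hypothesis terms of ONE stage-2 implementation's
mirrored jsons (`B1g` witness + `A2g`/`B2g`/`E` floors at `δ = 0.05`; `B1g` floor at `δ = 0.30`), none re-derived in Lean; only the two
μ-brackets are kernel-discharged.  RECORD-class, not DECIDED.
-/

noncomputable section
set_option linter.dupNamespace false

namespace Summit.HubbardSuperconductivity.HubbardSuperconductivity.Theorems

open Literature.MathematicalPhysics.QuantumLattice
open Summit.HubbardSuperconductivity.HubbardSuperconductivity.Theorems.CwKLChiralWindow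
open Summit.HubbardSuperconductivity.HubbardSuperconductivity.Theorems.KlNotB1g

namespace KlDualOrder

/-! ## §6 Two-sided route-P rows as named hypothesis KINDS (parametrised `Prop` families) -/

/-- **Form floor of channel `χ`** on `[a, b]` (additive kind): the `U = 1` Lindhard form on normalised `χ` channel states is `≥ Λ`.
`ChannelFormFloor a b B1g Λ` is p721574's `B1gFormFloor a b Λ` (`channelFormFloor_b1g_iff`). [folklore] -/
def ChannelFormFloor (a b : ℚ) (χ : D4Irrep) (Λ : ℚ) : Prop :=
  ∀ μ ∈ Set.Icc ((a : ℚ) : ℝ) ((b : ℚ) : ℝ), ∀ ψ, IsChannelState (squareDispersion 1 0) μ χ ψ →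
    ((Λ : ℚ) : ℝ) ≤ ∫ k, ψ k * ∫ k', lindhardFunction (squareDispersion 1 0) μ (k + k') * ψ k'
      ∂fermiCurveMeasure (squareDispersion 1 0) μ ∂fermiCurveMeasure (squareDispersion 1 0) μ

/-- `ChannelFormFloor a b B1g Λ` is, definitionally, p721574's `B1gFormFloor a b Λ`. [folklore] -/
theorem channelFormFloor_b1g_iff (a b Λ : ℚ) : ChannelFormFloor a b D4Irrep.B1g Λ ↔ B1gFormFloor a b Λ := Iff.rfl

/-- **Form witness of the `B1g` block** on `[a, b]` (Ritz direction): at every `μ` some normalised `B1g` channel state has Lindhard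
form `≤ Λ`.  Route-P provenance: `UB_matrix + E_B1g` (Galerkin bottom vector transferred to the continuum). [folklore] -/
def B1gFormWitness (a b Λ : ℚ) : Prop :=
  ∀ μ ∈ Set.Icc ((a : ℚ) : ℝ) ((b : ℚ) : ℝ), ∃ ψ, IsChannelState (squareDispersion 1 0) μ D4Irrep.B1g ψ ∧
    ∫ k, ψ k * ∫ k', lindhardFunction (squareDispersion 1 0) μ (k + k') * ψ k'
      ∂fermiCurveMeasure (squareDispersion 1 0) μ ∂fermiCurveMeasure (squareDispersion 1 0) μ ≤ ((Λ : ℚ) : ℝ)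

/-- **The two-sided route-P rows of one μ-cell** that a margin FLOOR needs: a `B1g` witness `Λ⁺` and form floors for the three
rivals `A2g, B2g, E` of `rivalMargin`. [folklore] -/
def RoutePTwoSided (a b ΛB ΛA2 ΛB2 ΛE : ℚ) : Prop :=
  B1gFormWitness a b ΛB ∧ ChannelFormFloor a b D4Irrep.A2g ΛA2 ∧ ChannelFormFloor a b D4Irrep.B2g ΛB2 ∧
    ChannelFormFloor a b D4Irrep.E ΛE

/-- A form floor is a floor of `channelInf` at `U = 1`, any channel `χ ≠ A1g` (`kl_bs_pairingForm_eq`; empty state set: junk `0 ≥ Λ`).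
The `B1g` case is p721574's `le_channelInf_b1g_of_formFloor`. [folklore] -/
theorem le_channelInf_of_formFloor {μ Λ : ℝ} {χ : D4Irrep} (hμ : μ ∈ Set.Ioo (-4 : ℝ) 0) (hχ : χ ≠ D4Irrep.A1g) (hΛ : Λ ≤ 0)
    (hlow : ∀ ψ, IsChannelState (squareDispersion 1 0) μ χ ψ →
      Λ ≤ ∫ k, ψ k * ∫ k', lindhardFunction (squareDispersion 1 0) μ (k + k') * ψ k'
        ∂fermiCurveMeasure (squareDispersion 1 0) μ ∂fermiCurveMeasure (squareDispersion 1 0) μ) :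
    Λ ≤ channelInf (squareDispersion 1 0) μ 1 χ := by
  unfold channelInf
  set S := pairingForm (squareDispersion 1 0) μ 1 '' {ψ | IsChannelState (squareDispersion 1 0) μ χ ψ} with hS
  rcases S.eq_empty_or_nonempty with hSe | hSne
  · rw [hSe, Real.sInf_empty]
    exact hΛ
  · apply le_csInf hSne
    rintro _ ⟨ψ, hψ, rfl⟩
    rw [kl_bs_pairingForm_eq hμ hχ hψ]
    exact hlow ψ hψ

/-- A form witness is a ceiling of `channelInf B1g` at `U = 1` (`csInf_le`; the image set is bounded below, `kl_rl_bddBelow`). [folklore] -/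
theorem channelInf_b1g_le_of_witness {μ Λ : ℝ} (hμ : μ ∈ Set.Ioo (-4 : ℝ) 0)
    (hwit : ∃ ψ, IsChannelState (squareDispersion 1 0) μ D4Irrep.B1g ψ ∧
      ∫ k, ψ k * ∫ k', lindhardFunction (squareDispersion 1 0) μ (k + k') * ψ k'
        ∂fermiCurveMeasure (squareDispersion 1 0) μ ∂fermiCurveMeasure (squareDispersion 1 0) μ ≤ Λ) :
    channelInf (squareDispersion 1 0) μ 1 D4Irrep.B1g ≤ Λ := by
  obtain ⟨ψ, hψ, hle⟩ := hwit
  unfold channelInf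
  have h1 : sInf (pairingForm (squareDispersion 1 0) μ 1 '' {ψ | IsChannelState (squareDispersion 1 0) μ D4Irrep.B1g ψ}) ≤
      pairingForm (squareDispersion 1 0) μ 1 ψ :=
    csInf_le (kl_rl_bddBelow hμ.1 hμ.2 1 D4Irrep.B1g) ⟨ψ, hψ, rfl⟩
  rw [kl_bs_pairingForm_eq hμ (by decide) hψ] at h1
  exact h1.trans hle

/-- **Soundness of the two-sided FLOOR**: `RoutePTwoSided a b ΛB ΛA2 ΛB2 ΛE` with `[a, b] ⊂ (−4, 0)` and non-positive rival floors gives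
`min (min ΛA2 ΛB2) ΛE − ΛB ≤ m(μ)` on `[a, b]`. [folklore] -/
theorem le_rivalMargin_of_routePTwoSided (a b ΛB ΛA2 ΛB2 ΛE : ℚ) (h4 : -4 < a) (h0 : b < 0)
    (hA : ΛA2 ≤ 0) (hB : ΛB2 ≤ 0) (hE : ΛE ≤ 0) (hP : RoutePTwoSided a b ΛB ΛA2 ΛB2 ΛE) :
    ∀ μ ∈ Set.Icc ((a : ℚ) : ℝ) ((b : ℚ) : ℝ), ((min (min ΛA2 ΛB2) ΛE - ΛB : ℚ) : ℝ) ≤ rivalMargin μ := by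
  obtain ⟨hW, hA2, hB2, hEE⟩ := hP
  intro μ hμ
  have hμo : μ ∈ Set.Ioo (-4 : ℝ) 0 :=
    ⟨lt_of_lt_of_le (by exact_mod_cast h4) hμ.1, lt_of_le_of_lt hμ.2 (by exact_mod_cast h0)⟩
  have cB : channelInf (squareDispersion 1 0) μ 1 D4Irrep.B1g ≤ ((ΛB : ℚ) : ℝ) :=
    channelInf_b1g_le_of_witness hμo (hW μ hμ)
  have cA2 : ((ΛA2 : ℚ) : ℝ) ≤ channelInf (squareDispersion 1 0) μ 1 D4Irrep.A2g :=
    le_channelInf_of_formFloor hμo (by decide) (by exact_mod_cast hA) (hA2 μ hμ)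
  have cB2 : ((ΛB2 : ℚ) : ℝ) ≤ channelInf (squareDispersion 1 0) μ 1 D4Irrep.B2g :=
    le_channelInf_of_formFloor hμo (by decide) (by exact_mod_cast hB) (hB2 μ hμ)
  have cE : ((ΛE : ℚ) : ℝ) ≤ channelInf (squareDispersion 1 0) μ 1 D4Irrep.E :=
    le_channelInf_of_formFloor hμo (by decide) (by exact_mod_cast hE) (hEE μ hμ)
  unfold rivalMargin
  have hmin : ((min (min ΛA2 ΛB2) ΛE : ℚ) : ℝ) ≤
      min (min (channelInf (squareDispersion 1 0) μ 1 D4Irrep.A2g) (channelInf (squareDispersion 1 0) μ 1 D4Irrep.B2g))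
        (channelInf (squareDispersion 1 0) μ 1 D4Irrep.E) := by
    push_cast
    exact min_le_min (min_le_min cA2 cB2) cE
  push_cast at hmin ⊢
  linarith

/-! ## §7 END TO END: the second pair `m(0.30) < m(0.05)`, route-P currency on both sides (zero kit, zero fetch) -/

/-- **By-value legs (kernel)**: floor `min(−199/500, −37/200, −89/250) − (−263/500) = 16/125 = 0.128` at `δ ≈ 0.05`; ceiling
`9/80 = 0.1125` at `δ ≈ 0.30`; `0.1125 < 0.128`. [folklore] -/
example : min (min ((-199 : ℚ) / 500) ((-37 : ℚ) / 200)) ((-89 : ℚ) / 250) - (-263) / 500 = 16 / 125 ∧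
    (9 : ℚ) / 80 < 16 / 125 := by
  refine ⟨by norm_num [min_def], by norm_num⟩

/-- **HQ1 (ii), SECOND INSTANCE, route-P currency end to end** (target «MarginOrderT0_d005_d030» = `MarginOrderT0 (1/20) (3/10)`):
`m(δ = 0.30) < m(δ = 0.05)` at `t′ = 0`, modulo the two named route-P record hypotheses «RoutePTwoSidedD005» :=
`RoutePTwoSided (−2/25) (−3/40) (−263/500) (−199/500) (−37/200) (−89/250)` (floor `0.128` on the tree bracket of `μ(0.05)`) and
«RoutePB1gFloorD030» := `B1gFormFloor (−29/40) (−287/400) (−9/80)` (ceiling `0.1125`), written as explicit hypothesis TERMS (parameterless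
`Prop` definitions in `Theorems/` files are relocated by the gate), plus the two μ-brackets: the tree's `muOfDoping_d005_mem_Icc`
(✓ p720129) and the companion `muOfDoping_d030_mem_Icc` (`…KlDualOrderBracketD030`, kernel-certified, r19) — taken here as hypotheses of
exactly those types so that this module checks against the tree alone. [folklore] -/
theorem marginOrderT0_d005_d030_of_routeP
    (hP : RoutePTwoSided (-2 / 25) (-3 / 40) (-263 / 500) (-199 / 500) (-37 / 200) (-89 / 250))
    (hF : B1gFormFloor (-29 / 40) (-287 / 400) (-9 / 80))
    (hμ₁ : chemicalPotentialOfDensity (squareDispersion 1 0) (1 - 1 / 20) ∈ Set.Icc (-(2 : ℝ) / 25) (-(3 : ℝ) / 40))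
    (hμ₂ : chemicalPotentialOfDensity (squareDispersion 1 0) (1 - 3 / 10) ∈
      Set.Icc (-(29 : ℝ) / 40) (-(287 : ℝ) / 400)) :
    MarginOrderT0 (1 / 20) (3 / 10) := by
  have hceil := rivalMargin_le_of_b1gFormFloor (-29 / 40) (-287 / 400) (-9 / 80)
    (by norm_num) (by norm_num) (by norm_num) hF
  have hfloor := le_rivalMargin_of_routePTwoSided (-2 / 25) (-3 / 40) (-263 / 500) (-199 / 500) (-37 / 200) (-89 / 250)
    (by norm_num) (by norm_num) (by norm_num) (by norm_num) (by norm_num) hP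
  have hμ₁' : chemicalPotentialOfDensity (squareDispersion 1 0) (1 - 1 / 20) ∈
      Set.Icc ((((-2 : ℚ) / 25 : ℚ)) : ℝ) ((((-3 : ℚ) / 40 : ℚ)) : ℝ) :=
    ⟨by push_cast; linarith [hμ₁.1], by push_cast; linarith [hμ₁.2]⟩
  have hμ₂' : chemicalPotentialOfDensity (squareDispersion 1 0) (1 - 3 / 10) ∈
      Set.Icc ((((-29 : ℚ) / 40 : ℚ)) : ℝ) ((((-287 : ℚ) / 400 : ℚ)) : ℝ) :=
    ⟨by push_cast; linarith [hμ₂.1], by push_cast; linarith [hμ₂.2]⟩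
  have hκ : -((((-9 : ℚ) / 80 : ℚ)) : ℝ) <
      (((min (min ((-199 : ℚ) / 500) ((-37 : ℚ) / 200)) ((-89 : ℚ) / 250) - (-263) / 500 : ℚ)) : ℝ) := by
    have : min (min ((-199 : ℚ) / 500) ((-37 : ℚ) / 200)) ((-89 : ℚ) / 250) - (-263) / 500 = 16 / 125 := by
      norm_num [min_def]
    rw [this]; push_cast; norm_num
  exact rivalMargin_lt_of_ceiling_floor hκ hfloor hceil _ hμ₁' _ hμ₂'

/-- **The two large-doping cells sit strictly below `δ = 0.05`** — the landed pair and this one side by side (four hypothesis terms: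
p721574's two + this file's two; the `δ = 0.05` floor is certified twice, in the Ritz/far currency `0.105` and in the route-P currency `0.128`).
[folklore] -/
theorem marginOrderT0_d005_below_both (hE : klCertB1gWinD.EnclosuresB1g)
    (hF35 : B1gFormFloor (-4431 / 5000) (-353 / 400) (-33 / 500))
    (hP : RoutePTwoSided (-2 / 25) (-3 / 40) (-263 / 500) (-199 / 500) (-37 / 200) (-89 / 250))
    (hF30 : B1gFormFloor (-29 / 40) (-287 / 400) (-9 / 80))
    (hμ₂ : chemicalPotentialOfDensity (squareDispersion 1 0) (1 - 3 / 10) ∈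
      Set.Icc (-(29 : ℝ) / 40) (-(287 : ℝ) / 400)) :
    MarginOrderT0 (1 / 20) (7 / 20) ∧ MarginOrderT0 (1 / 20) (3 / 10) :=
  ⟨marginOrderT0_d005_d035 hE hF35, marginOrderT0_d005_d030_of_routeP hP hF30 muOfDoping_d005_mem_Icc hμ₂⟩

/-- **`m(0.30) < m(0.05)` modulo the two route-P record hypotheses only** — the μ-brackets discharged by the tree's
`muOfDoping_d005_mem_Icc` (✓ p720129) and `muOfDoping_d030_mem_Icc` (`…KlDualOrderBracketD030`, kernel certificates). [folklore] -/
theorem marginOrderT0_d005_d030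
    (hP : RoutePTwoSided (-2 / 25) (-3 / 40) (-263 / 500) (-199 / 500) (-37 / 200) (-89 / 250))
    (hF : B1gFormFloor (-29 / 40) (-287 / 400) (-9 / 80)) :
    MarginOrderT0 (1 / 20) (3 / 10) :=
  marginOrderT0_d005_d030_of_routeP hP hF muOfDoping_d005_mem_Icc muOfDoping_d030_mem_Icc

/-- **Both certified large-doping cells sit strictly below `δ = 0.05`**: `m(0.35) < m(0.05) ∧ m(0.30) < m(0.05)` at `t′ = 0`, modulo
p721574's two hypothesis terms and this file's two, all brackets discharged. [folklore] -/
theorem marginOrderT0_d005_below_d030_d035 (hE : klCertB1gWinD.EnclosuresB1g)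
    (hF35 : B1gFormFloor (-4431 / 5000) (-353 / 400) (-33 / 500))
    (hP : RoutePTwoSided (-2 / 25) (-3 / 40) (-263 / 500) (-199 / 500) (-37 / 200) (-89 / 250))
    (hF30 : B1gFormFloor (-29 / 40) (-287 / 400) (-9 / 80)) :
    MarginOrderT0 (1 / 20) (7 / 20) ∧ MarginOrderT0 (1 / 20) (3 / 10) :=
  marginOrderT0_d005_below_both hE hF35 hP hF30 muOfDoping_d030_mem_Icc

end KlDualOrder

end Summit.HubbardSuperconductivity.HubbardSuperconductivity.Theorems

end
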